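import Mathlib
import Summits.KontsevichZagierPeriods.Zeta5Search.FourthOrderConj
import Summits.KontsevichZagierPeriods.Zeta5Search.FourthOrderBracket
import Summits.KontsevichZagierPeriods.Zeta5Search.SelfConjugateOddProof
import Summits.KontsevichZagierPeriods.Zeta5Search.ThirdOrderRaisePair
import HarnessLib

/-!
# ζ(5) search — gen-2 g14's LEMMA R in CUBIC FORM: `ĝ_x̄ Q_x̄(Y) ≡ (−1)^{E+1} ĝ_x Q_x(L − Y)` coefficientwise `(mod p⁴)`

Cell `pub-zeta5` (HONEST FRAMING: systematic search; no irrationality claim unless certified), typer seat generation 13.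
REPORT-gen2-g14 §2, Lemma R truncated at the cubic Taylor polynomial `Q_x = fourthQ` of the foreign factor: the polynomial
`D_x(Y) := ĝ_x̄·Q_x̄(Y) − (−1)^{E_x+1} ĝ_x·Q_x(L − Y)` (`reflD`; `x̄ = conjClass b p x`, `L` the top level) has ALL its coefficients of
`p`-adic norm `≤ p⁻⁴` (`padicNorm_reflD_coeff_le`).  The four coefficients are `d₀ = ĝ_x̄ − (−1)^{E+1}ĝ_x(1 − Lpφ + L²p²c − L³p³c₃)`
(`gHat_conj_fourth` of gen-2 g15 — extended here to the self-conjugate odd-centre class, where it follows from `φ ≡ −(L/2)pφ₂`,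
`Lφ₃ ≡ 0`, `c₃ ≡ 0`), `d₁ = −p[ĝ_x̄φ_x̄ + (−1)^{E+1}ĝ_x(φ − 2pcL + 3p²c₃L²)]`, `d₂ = p²[ĝ_x̄c_x̄ − (−1)^{E+1}ĝ_x(c − 3pc₃L)]`,
`d₃ = −p³[ĝ_x̄c₃,x̄ + (−1)^{E+1}ĝ_xc₃,x]`, each reduced to `FourthOrderConj` by an explicit algebraic identity.
`p`-adic norms of rational numbers; nothing here bears on irrationality.
-/

noncomputable section

open Finset

namespace Summit.KontsevichZagierPeriods.Zeta5Search.SecondOrder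

open Summit.KontsevichZagierPeriods.Zeta5Search.CasoratianValuation (InPolytope)
open Summit.KontsevichZagierPeriods.Zeta5Search.ClusterValuation
open Summit.KontsevichZagierPeriods.Zeta5Search.PadicSeries
open Summit.KontsevichZagierPeriods.Zeta5Search.CellA (padicNorm_p)
open Summit.KontsevichZagierPeriods.Zeta5Search.LevelClass (level_mem)
open Summit.KontsevichZagierPeriods.Zeta5Search.BigPrime (padicNorm_mul_le_one)
open Summit.KontsevichZagierPeriods.Zeta5Search.CellKit (conj_level)
open Summit.KontsevichZagierPeriods.Zeta5Search.SecondResidueLaw (phi3Hat cubicHat)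

variable {p : ℕ} [hp : Fact p.Prime]

/-! ## §0 Norm bookkeeping -/

/-- `‖a + c‖ ≤ B` from `‖a‖, ‖c‖ ≤ B`. -/
theorem fo_add {a c B : ℚ} (ha : padicNorm p a ≤ B) (hc : padicNorm p c ≤ B) : padicNorm p (a + c) ≤ B :=
  (padicNorm.nonarchimedean (p := p)).trans (max_le ha hc)

/-- `‖a − c‖ ≤ B` from `‖a‖, ‖c‖ ≤ B`. -/
theorem fo_sub {a c B : ℚ} (ha : padicNorm p a ≤ B) (hc : padicNorm p c ≤ B) : padicNorm p (a - c) ≤ B :=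
  (padicNorm.sub (p := p)).trans (max_le ha hc)

/-- `‖a·c‖ ≤ p^{−(j+k)}` from `‖a‖ ≤ p^{−j}`, `‖c‖ ≤ p^{−k}`. -/
theorem fo_mul {a c : ℚ} {j k : ℤ} (ha : padicNorm p a ≤ (p : ℚ) ^ (-j)) (hc : padicNorm p c ≤ (p : ℚ) ^ (-k)) :
    padicNorm p (a * c) ≤ (p : ℚ) ^ (-(j + k)) := by
  rw [padicNorm.mul, show -(j + k) = -j + -k by ring, zpow_add₀ (Nat.cast_ne_zero.2 hp.out.ne_zero)]
  exact mul_le_mul ha hc (padicNorm.nonneg _) (zpow_p_nonneg _)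

/-- Integral times small. -/
theorem fo_imul {a c : ℚ} {k : ℤ} (ha : padicNorm p a ≤ 1) (hc : padicNorm p c ≤ (p : ℚ) ^ (-k)) :
    padicNorm p (a * c) ≤ (p : ℚ) ^ (-k) := by
  have h := fo_mul (j := 0) (by simpa using ha) hc
  simpa using h

/-- Weakening. -/
theorem fo_weak {a : ℚ} {j k : ℤ} (ha : padicNorm p a ≤ (p : ℚ) ^ (-j)) (hkj : k ≤ j) : padicNorm p a ≤ (p : ℚ) ^ (-k) :=
  ha.trans (zpow_le_zpow_right₀ one_le_p (by omega))

/-- `‖p^j‖ = p^{−j}`. -/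
theorem fo_ppow (j : ℕ) : padicNorm p ((p : ℚ) ^ j) ≤ (p : ℚ) ^ (-(j : ℤ)) := by
  rw [CellA.padicNorm_pow_eq, padicNorm_p, ← zpow_natCast, ← zpow_mul]; simp

/-- `‖(−1)^e · a‖ = ‖a‖`. -/
theorem padicNorm_neg_one_zpow_mul (e : ℤ) (a : ℚ) : padicNorm p ((-1 : ℚ) ^ e * a) = padicNorm p a := by
  rw [padicNorm.mul]
  rcases Int.even_or_odd e with h | h
  · rw [h.neg_one_zpow, padicNorm.one, one_mul]
  · rw [h.neg_one_zpow, padicNorm.neg, padicNorm.one, one_mul]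

/-! ## §1 The cubic invariants -/

omit hp in
/-- gen-2 g14's `phi3Expl` is g13's `phi3Hat`. -/
theorem phi3Expl_eq_phi3Hat (b : ℕ → ℤ) (p x : ℕ) : phi3Expl b p x = phi3Hat b p x := rfl

omit hp in
/-- `c₃ = (φ³ − 3φφ₂ + 2φ₃)/6`. -/
theorem cubicHat_eq (b : ℕ → ℤ) (p x : ℕ) :
    cubicHat b p x = (phiHat b p x ^ 3 - 3 * phiHat b p x * phi2Hat b p x + 2 * phi3Expl b p x) / 6 := by
  unfold cubicHat; rw [phi3Expl_eq_phi3Hat]; ring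

/-- `‖c₃,x‖ ≤ 1` (`p ≥ 5`). -/
theorem padicNorm_cubicHat_le_one (b : ℕ → ℤ) (hp5 : 5 ≤ p) (x : ℕ) : padicNorm p (cubicHat b p x) ≤ 1 := by
  have hp2 : p ≠ 2 := by omega
  rw [cubicHat_eq, padicNorm.div, padicNorm_six hp5, div_one]
  have hφ := padicNorm_phiHat_le_one b hp2 x
  have hφ2 := padicNorm_phi2Hat_le_one b hp2 x
  have hφ3 := padicNorm_phi3Expl_le_one b hp2 x
  have h3 : padicNorm p (3 : ℚ) ≤ 1 := by simpa using padicNorm.of_nat (p := p) 3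
  have h2 : padicNorm p (2 : ℚ) ≤ 1 := by simpa using padicNorm.of_nat (p := p) 2
  refine fo_add (fo_sub ?_ (padicNorm_mul_le_one (padicNorm_mul_le_one h3 hφ) hφ2)) (padicNorm_mul_le_one h2 hφ3)
  rw [CellA.padicNorm_pow_eq]; exact pow_le_one₀ (padicNorm.nonneg _) hφ

/-! ## §2 The cubic `D_x` and its coefficients -/

/-- **`D_x(Y) := ĝ_x̄ Q_x̄(Y) − (−1)^{E_x+1} ĝ_x Q_x(L − Y)`** (`L` the top level of the class of `x`). -/
def reflD (b : ℕ → ℤ) (p x L : ℕ) : Polynomial ℚ :=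
  Polynomial.C (gHat b p (conjClass b p x)) * fourthQ b p (conjClass b p x)
    - Polynomial.C ((-1 : ℚ) ^ (classExp b p x + 1) * gHat b p x) * (fourthQ b p x).comp (Polynomial.C (L : ℚ) - Polynomial.X)

section Conj

variable (b : ℕ → ℤ) (hb : InPolytope b) (hp5 : 5 ≤ p) (hpn : (p : ℤ) ≤ b 0)
  {x L : ℕ} (hx : x < p) (hL : x + L * p ≤ (b 0).toNat) (hL' : (b 0).toNat < x + L * p + p)
include hb hp5 hpn hx hL hL'

/-- **`d₀`: the conjugate unit to fourth order, INCLUDING the self-conjugate odd-centre class.** -/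
theorem gHat_conj_fourth' (hpole : 1 ≤ classPoleCount b p x) :
    padicNorm p (gHat b p (conjClass b p x) - (-1 : ℚ) ^ (classExp b p x + 1) * (gHat b p x *
      (1 - (L : ℚ) * p * phiHat b p x + ((L : ℚ) * p) ^ 2 * curvHat b p x - ((L : ℚ) * p) ^ 3 * cubicHat b p x)))
      ≤ (p : ℚ) ^ (-(4 : ℤ)) := by
  have hp2 : p ≠ 2 := by omega
  by_cases hc : CentreIn b p x
  · -- self-conjugate: `x̄ = x`, `E` odd, and `Lpφ − L²p²c + L³p³c₃ ≡ 0 (mod p⁴)`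
    have hpnN : p ≤ (b 0).toNat := by have := hb.1.1; omega
    have hself : conjClass b p x = x := (centreIn_iff_conjClass_eq b hpnN hx).1 hc
    have hodd : Odd (classExp b p x) := selfConjugateOdd_holds b p x hb hp.out hp5 hx hpole hc
    have hs : (-1 : ℚ) ^ (classExp b p x + 1) = 1 := (hodd.add_one).neg_one_zpow
    have hg := padicNorm_gHat_le_one' b hp5 x
    have hφ := padicNorm_phiHat_le_one b hp2 x
    have hφ2 := padicNorm_phi2Hat_le_one b hp2 x
    have hφ3 := padicNorm_phi3Expl_le_one b hp2 x
    have hLn : padicNorm p (L : ℚ) ≤ 1 := by simpa using padicNorm.of_nat (p := p) L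
    have hpp : padicNorm p (p : ℚ) ≤ (p : ℚ) ^ (-(1 : ℤ)) := le_of_eq padicNorm_p
    -- the three self-conjugate congruences
    have hB := phiHat_conj_third b hb hp5 hx hL hL'
    have hB2 := phi2Hat_conj_second b hb hp5 hx hL hL'
    have hB3 := cubicExpl_conj b hb hp5 hx hL hL'
    rw [hself] at hB hB2 hB3
    have hφs : padicNorm p (phiHat b p x) ≤ (p : ℚ) ^ (-(1 : ℤ)) := phiHat_centre_small b hb hp5 hx hL hL' hpn hc
    -- `c₃ ≡ 0`: `2c₃` small and `p ≠ 2`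
    have hc3 : padicNorm p (cubicHat b p x) ≤ (p : ℚ) ^ (-(1 : ℤ)) := by
      have e : cubicHat b p x = (1 / 2 : ℚ) * ((phiHat b p x ^ 3 - 3 * phiHat b p x * phi2Hat b p x + 2 * phi3Expl b p x) / 6
          + (phiHat b p x ^ 3 - 3 * phiHat b p x * phi2Hat b p x + 2 * phi3Expl b p x) / 6) := by
        rw [cubicHat_eq]; ring
      rw [e]
      exact fo_imul (by rw [padicNorm.div, padicNorm.one, padicNorm_two hp2]; norm_num) hB3
    -- `Lφ₃ ≡ 0`: from `2Lpφ₃` having norm `≤ p⁻²`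
    have hLφ3 : padicNorm p ((L : ℚ) * phi3Expl b p x) ≤ (p : ℚ) ^ (-(1 : ℤ)) := by
      have h2p : padicNorm p (2 * (p : ℚ) * ((L : ℚ) * phi3Expl b p x)) ≤ (p : ℚ) ^ (-(2 : ℤ)) := by
        have e : 2 * (p : ℚ) * ((L : ℚ) * phi3Expl b p x) =
            -(phi2Hat b p x - (phi2Hat b p x + 2 * ((L : ℚ) * p) * phi3Expl b p x)) := by ring
        rw [e, padicNorm.neg]; exact hB2
      have hp0 : (p : ℚ) ≠ 0 := Nat.cast_ne_zero.2 hp.out.ne_zero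
      have e : (L : ℚ) * phi3Expl b p x = (1 / (2 * (p : ℚ))) * (2 * (p : ℚ) * ((L : ℚ) * phi3Expl b p x)) := by
        field_simp
      rw [e, padicNorm.mul, padicNorm.div, padicNorm.one, padicNorm.mul, padicNorm_two hp2, padicNorm_p, one_mul, one_div,
        ← zpow_neg, neg_neg]
      calc (p : ℚ) ^ (1 : ℤ) * _ ≤ (p : ℚ) ^ (1 : ℤ) * (p : ℚ) ^ (-(2 : ℤ)) := mul_le_mul_of_nonneg_left h2p (zpow_p_nonneg _)
        _ = (p : ℚ) ^ (-(1 : ℤ)) := by rw [← zpow_add₀ hp0]; norm_num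
    -- `2φ + Lpφ₂ + L²p²φ₃ ≡ 0 (mod p³)`
    have hφrel : padicNorm p (phiHat b p x + (1 / 2 : ℚ) * ((L : ℚ) * p * phi2Hat b p x + ((L : ℚ) * p) ^ 2 * phi3Expl b p x))
        ≤ (p : ℚ) ^ (-(3 : ℤ)) := by
      have e : phiHat b p x + (1 / 2 : ℚ) * ((L : ℚ) * p * phi2Hat b p x + ((L : ℚ) * p) ^ 2 * phi3Expl b p x) =
          (1 / 2 : ℚ) * (phiHat b p x + (phiHat b p x + (L : ℚ) * p * phi2Hat b p x + ((L : ℚ) * p) ^ 2 * phi3Expl b p x)) := by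
        ring
      rw [e]
      exact fo_imul (by rw [padicNorm.div, padicNorm.one, padicNorm_two hp2]; norm_num) hB
    -- the target, rewritten
    have e : gHat b p x - (1 : ℚ) * (gHat b p x *
        (1 - (L : ℚ) * p * phiHat b p x + ((L : ℚ) * p) ^ 2 * curvHat b p x - ((L : ℚ) * p) ^ 3 * cubicHat b p x)) =
        gHat b p x * ((L : ℚ) * p) * ((phiHat b p x + (1 / 2 : ℚ) * ((L : ℚ) * p * phi2Hat b p x + ((L : ℚ) * p) ^ 2 * phi3Expl b p x))
          - (1 / 2 : ℚ) * ((L : ℚ) * p) * (phiHat b p x * phiHat b p x)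
          - (1 / 2 : ℚ) * (p : ℚ) ^ 2 * (L : ℚ) * ((L : ℚ) * phi3Expl b p x)
          + ((L : ℚ) * p) ^ 2 * cubicHat b p x) := by
      unfold curvHat; ring
    rw [hself, hs, e]
    have h12 : padicNorm p (1 / 2 : ℚ) ≤ 1 := by rw [padicNorm.div, padicNorm.one, padicNorm_two hp2]; norm_num
    have hLp : padicNorm p ((L : ℚ) * p) ≤ (p : ℚ) ^ (-(1 : ℤ)) := padicNorm_mul_le_right hLn hpp
    have h4 : (-(4 : ℤ)) = -(1 + 3) := by norm_num
    rw [h4]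
    refine fo_mul (padicNorm_mul_le_right hg hLp) (fo_add (fo_sub (fo_sub hφrel ?_) ?_) ?_)
    · have := fo_mul (fo_imul h12 hLp) (fo_mul hφs hφs); exact fo_weak this (by norm_num)
    · have h' : padicNorm p ((1 / 2 : ℚ) * (p : ℚ) ^ 2 * (L : ℚ)) ≤ (p : ℚ) ^ (-(2 : ℤ)) :=
        padicNorm_mul_le_left (fo_imul h12 (fo_ppow 2)) hLn
      have := fo_mul h' hLφ3; exact fo_weak this (by norm_num)
    · have h' : padicNorm p (((L : ℚ) * p) ^ 2) ≤ (p : ℚ) ^ (-(2 : ℤ)) := by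
        rw [pow_two]; have := fo_mul hLp hLp; simpa using this
      have := fo_mul h' hc3; exact fo_weak this (by norm_num)
  · have h := gHat_conj_fourth b hb hp5 hx hL hL' hc
    rw [← cubicHat_eq] at h
    exact h

omit hp hb hp5 hpn hx hL hL' in
/-- The four coefficients of `D_x`. -/
theorem reflD_eq : reflD b p x L =
    Polynomial.C (gHat b p (conjClass b p x) - (-1 : ℚ) ^ (classExp b p x + 1) * gHat b p x *
        (1 - (L : ℚ) * p * phiHat b p x + ((L : ℚ) * p) ^ 2 * curvHat b p x - ((L : ℚ) * p) ^ 3 * cubicHat b p x))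
    + Polynomial.C (-(p : ℚ) * (gHat b p (conjClass b p x) * phiHat b p (conjClass b p x)
        + (-1 : ℚ) ^ (classExp b p x + 1) * gHat b p x *
          (phiHat b p x - 2 * p * curvHat b p x * L + 3 * (p : ℚ) ^ 2 * cubicHat b p x * (L : ℚ) ^ 2))) * Polynomial.X
    + Polynomial.C ((p : ℚ) ^ 2 * (gHat b p (conjClass b p x) * curvHat b p (conjClass b p x)
        - (-1 : ℚ) ^ (classExp b p x + 1) * gHat b p x * (curvHat b p x - 3 * p * cubicHat b p x * L))) * Polynomial.X ^ 2
    + Polynomial.C (-(p : ℚ) ^ 3 * (gHat b p (conjClass b p x) * cubicHat b p (conjClass b p x)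
        + (-1 : ℚ) ^ (classExp b p x + 1) * gHat b p x * cubicHat b p x)) * Polynomial.X ^ 3 := by
  unfold reflD fourthQ
  simp only [Polynomial.sub_comp, Polynomial.add_comp, Polynomial.mul_comp, Polynomial.C_comp, Polynomial.X_comp,
    Polynomial.pow_comp, Polynomial.one_comp, map_sub, map_add, map_mul, map_neg, map_pow, map_one, map_ofNat]
  ring

/-- **All coefficients of `D_x` have norm `≤ p⁻⁴`.** -/
theorem padicNorm_reflD_coeff_le (hpole : 1 ≤ classPoleCount b p x) (m : ℕ) :
    padicNorm p ((reflD b p x L).coeff m) ≤ (p : ℚ) ^ (-(4 : ℤ)) := by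
  have hp2 : p ≠ 2 := by omega
  have hp0 : (p : ℚ) ≠ 0 := Nat.cast_ne_zero.2 hp.out.ne_zero
  have h0 : 0 ≤ b 0 := hb.1.1
  have hxn : x ≤ (b 0).toNat := le_b0_of_lt b hpn hx
  set s : ℚ := (-1 : ℚ) ^ (classExp b p x + 1) with hsdef
  set g := gHat b p x
  set gb := gHat b p (conjClass b p x)
  set φ := phiHat b p x
  set φb := phiHat b p (conjClass b p x)
  set φ2 := phi2Hat b p x
  set φ2b := phi2Hat b p (conjClass b p x)
  set φ3 := phi3Expl b p x
  set φ3b := phi3Expl b p (conjClass b p x)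
  -- norms of the atoms
  have hg : padicNorm p g ≤ 1 := padicNorm_gHat_le_one' b hp5 x
  have hgb : padicNorm p gb ≤ 1 := padicNorm_gHat_le_one' b hp5 _
  have hφ : padicNorm p φ ≤ 1 := padicNorm_phiHat_le_one b hp2 x
  have hφb : padicNorm p φb ≤ 1 := padicNorm_phiHat_le_one b hp2 _
  have hφ2 : padicNorm p φ2 ≤ 1 := padicNorm_phi2Hat_le_one b hp2 x
  have hφ2b : padicNorm p φ2b ≤ 1 := padicNorm_phi2Hat_le_one b hp2 _
  have hφ3 : padicNorm p φ3 ≤ 1 := padicNorm_phi3Expl_le_one b hp2 x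
  have hφ3b : padicNorm p φ3b ≤ 1 := padicNorm_phi3Expl_le_one b hp2 _
  have hcb : padicNorm p (curvHat b p (conjClass b p x)) ≤ 1 := padicNorm_curvHat_le_one b hp2 _
  have hc3b : padicNorm p (cubicHat b p (conjClass b p x)) ≤ 1 := padicNorm_cubicHat_le_one b hp5 _
  have hLn : padicNorm p (L : ℚ) ≤ 1 := by simpa using padicNorm.of_nat (p := p) L
  have hs1 : padicNorm p s = 1 := by
    rcases Int.even_or_odd (classExp b p x + 1) with h | h
    · rw [hsdef, h.neg_one_zpow, padicNorm.one]
    · rw [hsdef, h.neg_one_zpow, padicNorm.neg, padicNorm.one]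
  have hsg : padicNorm p (s * g) ≤ 1 := padicNorm_mul_le_one hs1.le hg
  have hpp : padicNorm p (p : ℚ) ≤ (p : ℚ) ^ (-(1 : ℤ)) := le_of_eq padicNorm_p
  have hLp : padicNorm p ((L : ℚ) * p) ≤ (p : ℚ) ^ (-(1 : ℤ)) := padicNorm_mul_le_right hLn hpp
  have h12 : padicNorm p (1 / 2 : ℚ) ≤ 1 := by rw [padicNorm.div, padicNorm.one, padicNorm_two hp2]; norm_num
  have h16 : padicNorm p (1 / 6 : ℚ) ≤ 1 := by rw [padicNorm.div, padicNorm.one, padicNorm_six hp5]; norm_num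
  have hint : ∀ z : ℤ, padicNorm p (z : ℚ) ≤ 1 := fun z => padicNorm.of_int _
  -- the four error quantities
  set u₁ : ℚ := 1 - (L : ℚ) * p * φ + ((L : ℚ) * p) ^ 2 * curvHat b p x - ((L : ℚ) * p) ^ 3 * cubicHat b p x with hu₁
  set v : ℚ := φ + (L : ℚ) * p * φ2 + ((L : ℚ) * p) ^ 2 * φ3 with hv
  have hA : padicNorm p (gb - s * (g * u₁)) ≤ (p : ℚ) ^ (-(4 : ℤ)) := gHat_conj_fourth' b hb hp5 hpn hx hL hL' hpole
  have hB : padicNorm p (φb + v) ≤ (p : ℚ) ^ (-(3 : ℤ)) := phiHat_conj_third b hb hp5 hx hL hL'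
  have hB2 : padicNorm p (φ2b - (φ2 + 2 * ((L : ℚ) * p) * φ3)) ≤ (p : ℚ) ^ (-(2 : ℤ)) :=
    phi2Hat_conj_second b hb hp5 hx hL hL'
  have hB3 : padicNorm p (cubicHat b p (conjClass b p x) + cubicHat b p x) ≤ (p : ℚ) ^ (-(1 : ℤ)) := by
    rw [cubicHat_eq, cubicHat_eq]; exact cubicExpl_conj b hb hp5 hx hL hL'
  have hu₁n : padicNorm p u₁ ≤ 1 := by
    refine fo_sub (fo_add (fo_sub (by rw [padicNorm.one]) (padicNorm_mul_le_one (padicNorm_mul_le_one hLn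
      (padicNorm_p_le_one)) hφ)) (padicNorm_mul_le_one ?_ (padicNorm_curvHat_le_one b hp2 x)))
      (padicNorm_mul_le_one ?_ (padicNorm_cubicHat_le_one b hp5 x))
    all_goals rw [CellA.padicNorm_pow_eq]; exact pow_le_one₀ (padicNorm.nonneg _) (padicNorm_mul_le_one hLn padicNorm_p_le_one)
  have hvn : padicNorm p v ≤ 1 := by
    refine fo_add (fo_add hφ (padicNorm_mul_le_one (padicNorm_mul_le_one hLn padicNorm_p_le_one) hφ2)) (padicNorm_mul_le_one ?_ hφ3)
    rw [CellA.padicNorm_pow_eq]; exact pow_le_one₀ (padicNorm.nonneg _) (padicNorm_mul_le_one hLn padicNorm_p_le_one)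
  have hc := padicNorm_curvHat_le_one b hp2 x
  have hc3 := padicNorm_cubicHat_le_one b hp5 x
  have hpow : ∀ (t : ℚ) (n : ℕ), padicNorm p t ≤ 1 → padicNorm p (t ^ n) ≤ 1 := fun t n ht => by
    rw [CellA.padicNorm_pow_eq]; exact pow_le_one₀ (padicNorm.nonneg _) ht
  -- `d₁ = −p · inner₁`, `‖inner₁‖ ≤ p⁻³`
  have hd1 : padicNorm p (gb * φb + s * g * (φ - 2 * p * curvHat b p x * L + 3 * (p : ℚ) ^ 2 * cubicHat b p x * (L : ℚ) ^ 2))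
      ≤ (p : ℚ) ^ (-(3 : ℤ)) := by
    have e : gb * φb + s * g * (φ - 2 * p * curvHat b p x * L + 3 * (p : ℚ) ^ 2 * cubicHat b p x * (L : ℚ) ^ 2) =
        (gb - s * (g * u₁)) * φb + (s * g) * u₁ * (φb + v)
          + (s * g) * ((p : ℚ) ^ 3 * ((L : ℚ) ^ 3 * (φ * φ3 - curvHat b p x * φ2 + cubicHat b p x * φ)
              + p * (L : ℚ) ^ 4 * (cubicHat b p x * φ2 - curvHat b p x * φ3) + (p : ℚ) ^ 2 * (L : ℚ) ^ 5 * (cubicHat b p x * φ3))) := by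
      rw [hu₁, hv, cubicHat_eq]; unfold curvHat; ring
    rw [e]
    refine fo_add (fo_add (fo_weak (padicNorm_mul_le_left hA hφb) (by norm_num))
      (padicNorm_mul_le_right (padicNorm_mul_le_one hsg hu₁n) hB)) (padicNorm_mul_le_right hsg (padicNorm_mul_le_left (fo_ppow 3) ?_))
    refine fo_add (fo_add (padicNorm_mul_le_one (hpow _ 3 hLn) (fo_add (fo_sub (padicNorm_mul_le_one hφ hφ3)
      (padicNorm_mul_le_one hc hφ2)) (padicNorm_mul_le_one hc3 hφ))) ?_) ?_
    · exact padicNorm_mul_le_one (padicNorm_mul_le_one padicNorm_p_le_one (hpow _ 4 hLn))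
        (fo_sub (padicNorm_mul_le_one hc3 hφ2) (padicNorm_mul_le_one hc hφ3))
    · exact padicNorm_mul_le_one (padicNorm_mul_le_one (hpow _ 2 padicNorm_p_le_one) (hpow _ 5 hLn)) (padicNorm_mul_le_one hc3 hφ3)
  -- `d₂ = p² · inner₂`, `‖inner₂‖ ≤ p⁻²`
  have hd2 : padicNorm p (gb * curvHat b p (conjClass b p x) - s * g * (curvHat b p x - 3 * p * cubicHat b p x * L))
      ≤ (p : ℚ) ^ (-(2 : ℤ)) := by
    have e : gb * curvHat b p (conjClass b p x) - s * g * (curvHat b p x - 3 * p * cubicHat b p x * L) =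
        ((gb - s * (g * u₁)) + (s * g) * (((L : ℚ) * p) ^ 2 * curvHat b p x - ((L : ℚ) * p) ^ 3 * cubicHat b p x))
            * curvHat b p (conjClass b p x)
          + (s * g) * (1 - (L : ℚ) * p * φ) * (((φb + v) ^ 2 - 2 * (φb + v) * v - (φ2b - (φ2 + 2 * ((L : ℚ) * p) * φ3))) / 2
              + (p : ℚ) ^ 2 * (((L : ℚ) ^ 2 * φ2 ^ 2 + 2 * (L : ℚ) ^ 2 * φ * φ3 + 2 * (L : ℚ) ^ 3 * p * φ2 * φ3
                  + (L : ℚ) ^ 4 * (p : ℚ) ^ 2 * φ3 ^ 2) / 2))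
          + (s * g) * (-((L : ℚ) ^ 2 * (p : ℚ) ^ 2 * φ * (φ * φ2 - φ3))) := by
      rw [hu₁, hv, cubicHat_eq]; unfold curvHat; ring
    rw [e]
    refine fo_add (fo_add ?_ ?_) ?_
    · refine padicNorm_mul_le_left (fo_add (fo_weak hA (by norm_num)) (padicNorm_mul_le_right hsg (fo_sub ?_ ?_))) hcb
      · have := fo_mul (fo_mul hLp hLp) (show padicNorm p (curvHat b p x) ≤ (p : ℚ) ^ (-(0 : ℤ)) by simpa using hc)
        rw [pow_two]; exact fo_weak this (by norm_num)
      · have := fo_mul (fo_mul (fo_mul hLp hLp) hLp) (show padicNorm p (cubicHat b p x) ≤ (p : ℚ) ^ (-(0 : ℤ)) by simpa using hc3)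
        rw [pow_succ, pow_two]; exact fo_weak this (by norm_num)
    · refine padicNorm_mul_le_right (padicNorm_mul_le_one hsg (fo_sub (by rw [padicNorm.one])
        (padicNorm_mul_le_one (padicNorm_mul_le_one hLn padicNorm_p_le_one) hφ))) (fo_add ?_ ?_)
      · rw [padicNorm.div, padicNorm_two hp2, div_one]
        refine fo_sub (fo_sub ?_ ?_) hB2
        · rw [pow_two]; exact fo_weak (fo_mul hB hB) (by norm_num)
        · exact fo_weak (padicNorm_mul_le_left (padicNorm_mul_le_right (by simpa using padicNorm.of_nat (p := p) 2) hB) hvn)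
            (by norm_num)
      · refine padicNorm_mul_le_left (fo_ppow 2) ?_
        rw [padicNorm.div, padicNorm_two hp2, div_one]
        have h2' : padicNorm p (2 : ℚ) ≤ 1 := by simpa using padicNorm.of_nat (p := p) 2
        refine fo_add (fo_add (fo_add (padicNorm_mul_le_one (hpow _ 2 hLn) (hpow _ 2 hφ2))
          (padicNorm_mul_le_one (padicNorm_mul_le_one (padicNorm_mul_le_one h2' (hpow _ 2 hLn)) hφ) hφ3))
          (padicNorm_mul_le_one (padicNorm_mul_le_one (padicNorm_mul_le_one (padicNorm_mul_le_one h2' (hpow _ 3 hLn))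
            padicNorm_p_le_one) hφ2) hφ3)) ?_
        exact padicNorm_mul_le_one (padicNorm_mul_le_one (hpow _ 4 hLn) (hpow _ 2 padicNorm_p_le_one)) (hpow _ 2 hφ3)
    · refine padicNorm_mul_le_right hsg ?_
      rw [padicNorm.neg]
      exact padicNorm_mul_le_left (padicNorm_mul_le_left (padicNorm_mul_le_right (hpow _ 2 hLn) (fo_ppow 2)) hφ)
        (fo_sub (padicNorm_mul_le_one hφ hφ2) hφ3)
  -- `d₃ = −p³ · inner₃`, `‖inner₃‖ ≤ p⁻¹`
  have hd3 : padicNorm p (gb * cubicHat b p (conjClass b p x) + s * g * cubicHat b p x) ≤ (p : ℚ) ^ (-(1 : ℤ)) := by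
    have e : gb * cubicHat b p (conjClass b p x) + s * g * cubicHat b p x =
        gb * (cubicHat b p (conjClass b p x) + cubicHat b p x)
          - ((gb - s * (g * u₁)) + (s * g) * (((L : ℚ) * p) * (-φ + (L : ℚ) * p * curvHat b p x
              - ((L : ℚ) * p) ^ 2 * cubicHat b p x))) * cubicHat b p x := by
      rw [hu₁]; ring
    rw [e]
    refine fo_sub (padicNorm_mul_le_right hgb hB3) (padicNorm_mul_le_left (fo_add (fo_weak hA (by norm_num))
      (padicNorm_mul_le_right hsg (padicNorm_mul_le_left hLp ?_))) hc3)
    refine fo_sub (fo_add (by rw [padicNorm.neg]; exact hφ) (padicNorm_mul_le_one (padicNorm_mul_le_one hLn padicNorm_p_le_one) hc))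
      (padicNorm_mul_le_one (hpow _ 2 (padicNorm_mul_le_one hLn padicNorm_p_le_one)) hc3)
  -- the coefficients
  rw [reflD_eq b]
  simp only [Polynomial.coeff_add, Polynomial.coeff_C_mul, Polynomial.coeff_X_pow, Polynomial.coeff_X, Polynomial.coeff_C,
    mul_ite, mul_one, mul_zero]
  have hz : padicNorm p (0 : ℚ) ≤ (p : ℚ) ^ (-(4 : ℤ)) := by rw [padicNorm.zero]; exact zpow_p_nonneg _
  have hA' : padicNorm p (gb - s * g * u₁) ≤ (p : ℚ) ^ (-(4 : ℤ)) := by rw [mul_assoc]; exact hA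
  refine fo_add (fo_add (fo_add ?_ ?_) ?_) ?_
  · split_ifs
    · exact hA'
    · exact hz
  · split_ifs
    · rw [show (-(4 : ℤ)) = -(1 + 3) by norm_num]
      exact fo_mul (by rw [padicNorm.neg]; exact hpp) hd1
    · exact hz
  · split_ifs
    · rw [show (-(4 : ℤ)) = -(2 + 2) by norm_num]
      exact fo_mul (fo_ppow 2) hd2
    · exact hz
  · split_ifs
    · rw [show (-(4 : ℤ)) = -(3 + 1) by norm_num]
      exact fo_mul (by rw [padicNorm.neg]; exact fo_ppow 3) hd3
    · exact hz

end Conj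

end Summit.KontsevichZagierPeriods.Zeta5Search.SecondOrder

end
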